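import Summits.QuantumFields.YangMills.Theorems.AllWindowsColdBoxBoxHighLineHodgePoincareCore

/-!
# LINE-19 stub S1 `HodgePoincareColdBox` (crux `AllWindowsColdBox.BoxHighWindowsSU22`, stmt-QuantumFields-24004 / low item 24335),
# part 3: the boundary layer — every face-tangential box edge owns an exterior plaquette

Edges of the cube `[0,N]⁴` split into CORE edges (every transverse coordinate in `[1, N−1]`) and FACE-TANGENTIAL edges (some
transverse coordinate in `{0, N}`).  For an edge function `u` supported on the box edges and its core part `uc`
(`uc = u` on core edges, `0` elsewhere):
* `exterior_le_circ_sq` — a plaquette lying across a face of the cube (base coordinate `−1` or `N` in one of its two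
  directions) contains exactly one box edge, and its squared circulation is that squared edge value;
* `face_mass_pair_le` — summing these exterior plaquettes of one plane pair (two translated families are shifted back by part 1);
* `tangential_sq_le_count`, `tangential_mass_le` — **`‖u − uc‖² ≤ Σ_plaquettes circ(u)²`**: the face-tangential part costs
  order one, with no Poincaré constant.
Mathlib only (via parts 1–2).  HONEST LABEL: helper toward ONE registered stub of a critic-PASSed line; no crux, rung or
summit is proved; the Yang–Mills mass gap is NOT proved by this file.
-/

set_option autoImplicit false

open Finset

namespace Summit.QuantumFields.YangMills.Theorems.AllWindowsColdBoxBoxHighLine.HodgePoincare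

section Boundary

variable {N : ℕ} {u : (Fin 4 → ℤ) × Fin 4 → ℝ}
  (hsupp : ∀ x i, u (x, i) ≠ 0 → (∀ k, 0 ≤ x k ∧ x k ≤ N) ∧ x i + 1 ≤ N)

include hsupp in
/-- An edge value vanishes as soon as one coordinate of its base point leaves `[0, N]`. -/
theorem eq_zero_of_coord {y : Fin 4 → ℤ} {l : Fin 4} (k : Fin 4) (hk : y k < 0 ∨ (N : ℤ) < y k) : u (y, l) = 0 := by
  by_contra h
  have := (hsupp y l h).1 k
  omega

include hsupp in
/-- An edge value vanishes when the edge sticks out of the cube in its own direction. -/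
theorem eq_zero_of_dir {y : Fin 4 → ℤ} {l : Fin 4} (hl : (N : ℤ) < y l + 1) : u (y, l) = 0 := by
  by_contra h
  have := (hsupp y l h).2
  omega

include hsupp in
/-- **Exterior plaquettes.**  For `i ≠ j`, the squared circulation around the plaquette based at `z` in the plane `(i,j)`
dominates the squared value of the single box edge it contains whenever the plaquette lies outside the cube across a face:
base coordinate `z_j = −1` or `z_j = N` (resp. `z_i = −1`, `z_i = N`). -/
theorem exterior_le_circ_sq (z : Fin 4 → ℤ) {i j : Fin 4} (hij : i ≠ j) :
    (if z j = -1 then u (z + Pi.single j 1, i) ^ 2 else 0) + (if z j = N then u (z, i) ^ 2 else 0) +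
      (if z i = -1 then u (z + Pi.single i 1, j) ^ 2 else 0) + (if z i = N then u (z, j) ^ 2 else 0) ≤
      (u (z, i) + u (z + Pi.single i 1, j) - u (z + Pi.single j 1, i) - u (z, j)) ^ 2 := by
  have hji : j ≠ i := Ne.symm hij
  have ezi_j : (z + Pi.single i 1 : Fin 4 → ℤ) j = z j := by simp [Pi.single_eq_of_ne hji]
  have ezj_i : (z + Pi.single j 1 : Fin 4 → ℤ) i = z i := by simp [Pi.single_eq_of_ne hij]
  have ezi_i : (z + Pi.single i 1 : Fin 4 → ℤ) i = z i + 1 := by simp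
  have ezj_j : (z + Pi.single j 1 : Fin 4 → ℤ) j = z j + 1 := by simp
  by_cases h1 : z j = -1
  · have a1 : u (z, i) = 0 := eq_zero_of_coord hsupp j (by omega)
    have a2 : u (z + Pi.single i 1, j) = 0 := eq_zero_of_coord hsupp j (by rw [ezi_j]; omega)
    have a3 : u (z, j) = 0 := eq_zero_of_coord hsupp j (by omega)
    have hN : ¬ z j = N := by omega
    rw [if_pos h1, if_neg hN, a1, a2, a3]
    simp only [ne_eq, OfNat.ofNat_ne_zero, not_false_eq_true, zero_pow, ite_self, add_zero]
    nlinarith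
  by_cases h2 : z j = N
  · have a1 : u (z + Pi.single i 1, j) = 0 := eq_zero_of_dir hsupp (by rw [ezi_j]; omega)
    have a2 : u (z, j) = 0 := eq_zero_of_dir hsupp (by omega)
    have a3 : u (z + Pi.single j 1, i) = 0 := eq_zero_of_coord hsupp j (by rw [ezj_j]; omega)
    rw [if_neg h1, if_pos h2, a1, a2, a3]
    simp only [ne_eq, OfNat.ofNat_ne_zero, not_false_eq_true, zero_pow, ite_self, add_zero, zero_add]
    nlinarith
  by_cases h3 : z i = -1
  · have a1 : u (z, i) = 0 := eq_zero_of_coord hsupp i (by omega)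
    have a2 : u (z, j) = 0 := eq_zero_of_coord hsupp i (by omega)
    have a3 : u (z + Pi.single j 1, i) = 0 := eq_zero_of_coord hsupp i (by rw [ezj_i]; omega)
    have hN : ¬ z i = N := by omega
    rw [if_neg h1, if_neg h2, if_pos h3, if_neg hN, a1, a2, a3]
    simp only [zero_add, add_zero]
    nlinarith
  by_cases h4 : z i = N
  · have a1 : u (z, i) = 0 := eq_zero_of_dir hsupp (by omega)
    have a2 : u (z + Pi.single j 1, i) = 0 := eq_zero_of_dir hsupp (by rw [ezj_i]; omega)
    have a3 : u (z + Pi.single i 1, j) = 0 := eq_zero_of_coord hsupp i (by rw [ezi_i]; omega)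
    rw [if_neg h1, if_neg h2, if_neg h3, if_pos h4, a1, a2, a3]
    simp only [zero_add]
    nlinarith
  rw [if_neg h1, if_neg h2, if_neg h3, if_neg h4]
  simp only [add_zero]
  exact sq_nonneg _

include hsupp in
/-- Summing the exterior plaquettes of one plane pair over the cube `[-2,N+2]⁴` (and translating the two shifted families
back): `Σ_x (𝟙[x_j ∈ {0,N}]·u(x,i)² + 𝟙[x_i ∈ {0,N}]·u(x,j)²) ≤ Σ_z circ(z;i,j)²`. -/
theorem face_mass_pair_le {i j : Fin 4} (hij : i ≠ j) :
    ∑ x ∈ Fintype.piFinset (fun _ : Fin 4 => Finset.Icc (-2 : ℤ) (N + 2)),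
      ((if x j = 0 then u (x, i) ^ 2 else 0) + (if x j = N then u (x, i) ^ 2 else 0) +
        (if x i = 0 then u (x, j) ^ 2 else 0) + (if x i = N then u (x, j) ^ 2 else 0)) ≤
    ∑ z ∈ Fintype.piFinset (fun _ : Fin 4 => Finset.Icc (-2 : ℤ) (N + 2)),
      (u (z, i) + u (z + Pi.single i 1, j) - u (z + Pi.single j 1, i) - u (z, j)) ^ 2 := by
  have hsupp0 : ∀ x i, u (x, i) ≠ 0 → ∀ k, 0 ≤ x k ∧ x k ≤ N := fun x i h => (hsupp x i h).1
  -- the two translated families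
  have S1 : ∑ z ∈ Fintype.piFinset (fun _ : Fin 4 => Finset.Icc (-2 : ℤ) (N + 2)),
      (if z j = -1 then u (z + Pi.single j 1, i) ^ 2 else 0) =
      ∑ x ∈ Fintype.piFinset (fun _ : Fin 4 => Finset.Icc (-2 : ℤ) (N + 2)), (if x j = 0 then u (x, i) ^ 2 else 0) := by
    have key := sum_shift_eq (a := -2) (b := (N : ℤ) + 2) (Pi.single j 1)
      (fun x => if x j = 0 then u (x, i) ^ 2 else 0) ?_
    · refine Eq.trans (Finset.sum_congr rfl fun z _ => ?_) key
      have : (z + Pi.single j 1 : Fin 4 → ℤ) j = 0 ↔ z j = -1 := by simp; omega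
      simp only [this]
    · intro x hx
      have hx' : u (x, i) ≠ 0 := by
        intro h; apply hx; simp [h]
      have hb := hsupp0 x i hx'
      have he := single_one_apply_bounds j
      exact ⟨fun k => by have := hb k; constructor <;> omega,
        fun k => by have := hb k; have := he k; constructor <;> omega⟩
  have S2 : ∑ z ∈ Fintype.piFinset (fun _ : Fin 4 => Finset.Icc (-2 : ℤ) (N + 2)),
      (if z i = -1 then u (z + Pi.single i 1, j) ^ 2 else 0) =
      ∑ x ∈ Fintype.piFinset (fun _ : Fin 4 => Finset.Icc (-2 : ℤ) (N + 2)), (if x i = 0 then u (x, j) ^ 2 else 0) := by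
    have key := sum_shift_eq (a := -2) (b := (N : ℤ) + 2) (Pi.single i 1)
      (fun x => if x i = 0 then u (x, j) ^ 2 else 0) ?_
    · refine Eq.trans (Finset.sum_congr rfl fun z _ => ?_) key
      have : (z + Pi.single i 1 : Fin 4 → ℤ) i = 0 ↔ z i = -1 := by simp; omega
      simp only [this]
    · intro x hx
      have hx' : u (x, j) ≠ 0 := by
        intro h; apply hx; simp [h]
      have hb := hsupp0 x j hx'
      have he := single_one_apply_bounds i
      exact ⟨fun k => by have := hb k; constructor <;> omega,
        fun k => by have := hb k; have := he k; constructor <;> omega⟩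
  simp only [Finset.sum_add_distrib]
  rw [← S1, ← S2]
  have := Finset.sum_le_sum (s := Fintype.piFinset (fun _ : Fin 4 => Finset.Icc (-2 : ℤ) ((N : ℤ) + 2)))
    fun z _ => exterior_le_circ_sq hsupp z hij
  simp only [Finset.sum_add_distrib] at this
  linarith

/-- Face-tangential edges have at least one exterior plaquette: pointwise count.  With the CORE part
`uc (x,i) = u (x,i)` if every transverse coordinate of the edge lies in `[1, N−1]` and `0` otherwise,
`(u − uc)(x,i)² ≤ Σ_{j ≠ i} 𝟙[x_j ∈ {0, N}]·u(x,i)²`. -/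
theorem tangential_sq_le_count (hsupp : ∀ x i, u (x, i) ≠ 0 → (∀ k, 0 ≤ x k ∧ x k ≤ N) ∧ x i + 1 ≤ N)
    (uc : (Fin 4 → ℤ) × Fin 4 → ℝ)
    (huc : ∀ x i, uc (x, i) = if (∀ k, k ≠ i → 1 ≤ x k ∧ x k + 1 ≤ N) then u (x, i) else 0)
    (x : Fin 4 → ℤ) (i : Fin 4) :
    (u (x, i) - uc (x, i)) ^ 2 ≤
      ∑ j : Fin 4, (if i ≠ j then (if x j = 0 then u (x, i) ^ 2 else 0) + (if x j = N then u (x, i) ^ 2 else 0) else 0) := by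
  have hnn : ∀ j : Fin 4, 0 ≤ (if i ≠ j then (if x j = 0 then u (x, i) ^ 2 else 0) + (if x j = N then u (x, i) ^ 2 else 0) else 0) := by
    intro j; split_ifs <;> positivity
  by_cases hc : ∀ k, k ≠ i → 1 ≤ x k ∧ x k + 1 ≤ N
  · rw [huc, if_pos hc, sub_self]
    simp only [ne_eq, OfNat.ofNat_ne_zero, not_false_eq_true, zero_pow]
    exact Finset.sum_nonneg fun j _ => hnn j
  · rw [huc, if_neg hc, sub_zero]
    by_cases hu : u (x, i) = 0
    · have h0 : u (x, i) ^ 2 = 0 := by rw [hu]; ring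
      rw [h0]
      exact Finset.sum_nonneg fun j _ => by split_ifs <;> simp
    · obtain ⟨k, hk⟩ := not_forall.1 hc
      have hki : k ≠ i := by
        by_contra h; exact hk (fun h' => absurd h h')
      have hk' : ¬ (1 ≤ x k ∧ x k + 1 ≤ N) := fun h => hk (fun _ => h)
      have hb := (hsupp x i hu).1 k
      have hkval : x k = 0 ∨ x k = N := by omega
      refine le_trans ?_ (Finset.single_le_sum (fun j _ => hnn j) (Finset.mem_univ k))
      rw [if_pos (Ne.symm hki)]
      rcases hkval with h0 | hN
      · rw [if_pos h0]; split_ifs <;> nlinarith [sq_nonneg (u (x, i))]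
      · rw [if_pos hN]; split_ifs <;> nlinarith [sq_nonneg (u (x, i))]

include hsupp in
/-- **Face-tangential mass bound.**  The squared ℓ²-norm of the face-tangential part `u − uc` is bounded by the total
plaquette energy: every face-tangential box edge owns an exterior plaquette whose circulation is that edge value. -/
theorem tangential_mass_le (uc : (Fin 4 → ℤ) × Fin 4 → ℝ)
    (huc : ∀ x i, uc (x, i) = if (∀ k, k ≠ i → 1 ≤ x k ∧ x k + 1 ≤ N) then u (x, i) else 0) :
    ∑ x ∈ Fintype.piFinset (fun _ : Fin 4 => Finset.Icc (-2 : ℤ) (N + 2)), ∑ i : Fin 4, (u (x, i) - uc (x, i)) ^ 2 ≤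
      ∑ z ∈ Fintype.piFinset (fun _ : Fin 4 => Finset.Icc (-2 : ℤ) (N + 2)), ∑ i : Fin 4, ∑ j : Fin 4,
        (if i < j then (u (z, i) + u (z + Pi.single i 1, j) - u (z + Pi.single j 1, i) - u (z, j)) ^ 2 else 0) := by
  -- A i j := Σ_x 𝟙[x_j ∈ {0,N}] u(x,i)²
  have step1 : ∑ x ∈ Fintype.piFinset (fun _ : Fin 4 => Finset.Icc (-2 : ℤ) (N + 2)), ∑ i : Fin 4, (u (x, i) - uc (x, i)) ^ 2 ≤
      ∑ x ∈ Fintype.piFinset (fun _ : Fin 4 => Finset.Icc (-2 : ℤ) (N + 2)), ∑ i : Fin 4, ∑ j : Fin 4,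
        (if i ≠ j then (if x j = 0 then u (x, i) ^ 2 else 0) + (if x j = N then u (x, i) ^ 2 else 0) else 0) := by
    refine Finset.sum_le_sum fun x _ => Finset.sum_le_sum fun i _ => ?_
    exact tangential_sq_le_count hsupp uc huc x i
  refine step1.trans ?_
  -- rewrite the right-hand side pair by pair
  have pairs : ∀ i j : Fin 4, i ≠ j →
      ∑ x ∈ Fintype.piFinset (fun _ : Fin 4 => Finset.Icc (-2 : ℤ) (N + 2)),
        (((if x j = 0 then u (x, i) ^ 2 else 0) + (if x j = N then u (x, i) ^ 2 else 0)) +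
         ((if x i = 0 then u (x, j) ^ 2 else 0) + (if x i = N then u (x, j) ^ 2 else 0))) ≤
      ∑ z ∈ Fintype.piFinset (fun _ : Fin 4 => Finset.Icc (-2 : ℤ) (N + 2)),
        (u (z, i) + u (z + Pi.single i 1, j) - u (z + Pi.single j 1, i) - u (z, j)) ^ 2 := by
    intro i j hij
    have := face_mass_pair_le hsupp hij
    refine le_trans (le_of_eq ?_) this
    exact Finset.sum_congr rfl fun x _ => by ring
  -- symmetrisation of the index sum
  have hlhs : ∑ x ∈ Fintype.piFinset (fun _ : Fin 4 => Finset.Icc (-2 : ℤ) (N + 2)), ∑ i : Fin 4, ∑ j : Fin 4,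
        (if i ≠ j then (if x j = 0 then u (x, i) ^ 2 else 0) + (if x j = N then u (x, i) ^ 2 else 0) else 0) =
      ∑ i : Fin 4, ∑ j : Fin 4, (if i ≠ j then
        ∑ x ∈ Fintype.piFinset (fun _ : Fin 4 => Finset.Icc (-2 : ℤ) (N + 2)),
          ((if x j = 0 then u (x, i) ^ 2 else 0) + (if x j = N then u (x, i) ^ 2 else 0)) else 0) := by
    rw [Finset.sum_comm]
    refine Finset.sum_congr rfl fun i _ => ?_
    rw [Finset.sum_comm]
    refine Finset.sum_congr rfl fun j _ => ?_
    by_cases h : i ≠ j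
    · simp only [if_pos h]
    · simp only [if_neg h, Finset.sum_const_zero]
  have hrhs : ∑ z ∈ Fintype.piFinset (fun _ : Fin 4 => Finset.Icc (-2 : ℤ) (N + 2)), ∑ i : Fin 4, ∑ j : Fin 4,
        (if i < j then (u (z, i) + u (z + Pi.single i 1, j) - u (z + Pi.single j 1, i) - u (z, j)) ^ 2 else 0) =
      ∑ i : Fin 4, ∑ j : Fin 4, (if i < j then
        ∑ z ∈ Fintype.piFinset (fun _ : Fin 4 => Finset.Icc (-2 : ℤ) (N + 2)),
          (u (z, i) + u (z + Pi.single i 1, j) - u (z + Pi.single j 1, i) - u (z, j)) ^ 2 else 0) := by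
    rw [Finset.sum_comm]
    refine Finset.sum_congr rfl fun i _ => ?_
    rw [Finset.sum_comm]
    refine Finset.sum_congr rfl fun j _ => ?_
    by_cases h : i < j
    · simp only [if_pos h]
    · simp only [if_neg h, Finset.sum_const_zero]
  rw [hlhs, hrhs]
  -- A i j + A j i ≤ P i j with P symmetric; Σ_{i≠j} A i j = ½ Σ_{i≠j} (A i j + A j i) ≤ ½ Σ_{i≠j} P i j = Σ_{i<j} P i j
  have Psymm : ∀ i j : Fin 4,
      ∑ z ∈ Fintype.piFinset (fun _ : Fin 4 => Finset.Icc (-2 : ℤ) (N + 2)),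
          (u (z, i) + u (z + Pi.single i 1, j) - u (z + Pi.single j 1, i) - u (z, j)) ^ 2 =
      ∑ z ∈ Fintype.piFinset (fun _ : Fin 4 => Finset.Icc (-2 : ℤ) (N + 2)),
          (u (z, j) + u (z + Pi.single j 1, i) - u (z + Pi.single i 1, j) - u (z, i)) ^ 2 := by
    intro i j; exact Finset.sum_congr rfl fun z _ => by ring
  have h2 := sum_lt_eq_sum_ne (fun i j => ∑ z ∈ Fintype.piFinset (fun _ : Fin 4 => Finset.Icc (-2 : ℤ) (N + 2)),
          (u (z, i) + u (z + Pi.single i 1, j) - u (z + Pi.single j 1, i) - u (z, j)) ^ 2) Psymm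
  have hswap := sum_ne_add_swap (fun i j => ∑ x ∈ Fintype.piFinset (fun _ : Fin 4 => Finset.Icc (-2 : ℤ) (N + 2)),
          ((if x j = 0 then u (x, i) ^ 2 else 0) + (if x j = N then u (x, i) ^ 2 else 0)))
  have hsum : ∑ i : Fin 4, ∑ j : Fin 4, (if i ≠ j then
        (∑ x ∈ Fintype.piFinset (fun _ : Fin 4 => Finset.Icc (-2 : ℤ) (N + 2)),
          ((if x j = 0 then u (x, i) ^ 2 else 0) + (if x j = N then u (x, i) ^ 2 else 0)) +
         ∑ x ∈ Fintype.piFinset (fun _ : Fin 4 => Finset.Icc (-2 : ℤ) (N + 2)),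
          ((if x i = 0 then u (x, j) ^ 2 else 0) + (if x i = N then u (x, j) ^ 2 else 0))) else 0) ≤
      ∑ i : Fin 4, ∑ j : Fin 4, (if i ≠ j then
        ∑ z ∈ Fintype.piFinset (fun _ : Fin 4 => Finset.Icc (-2 : ℤ) (N + 2)),
          (u (z, i) + u (z + Pi.single i 1, j) - u (z + Pi.single j 1, i) - u (z, j)) ^ 2 else 0) := by
    refine Finset.sum_le_sum fun i _ => Finset.sum_le_sum fun j _ => ?_
    by_cases h : i ≠ j
    · rw [if_pos h, if_pos h, ← Finset.sum_add_distrib]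
      exact pairs i j h
    · rw [if_neg h, if_neg h]
  have hsplit : ∑ i : Fin 4, ∑ j : Fin 4, (if i ≠ j then
        (∑ x ∈ Fintype.piFinset (fun _ : Fin 4 => Finset.Icc (-2 : ℤ) (N + 2)),
          ((if x j = 0 then u (x, i) ^ 2 else 0) + (if x j = N then u (x, i) ^ 2 else 0)) +
         ∑ x ∈ Fintype.piFinset (fun _ : Fin 4 => Finset.Icc (-2 : ℤ) (N + 2)),
          ((if x i = 0 then u (x, j) ^ 2 else 0) + (if x i = N then u (x, j) ^ 2 else 0))) else 0) =
      ∑ i : Fin 4, ∑ j : Fin 4, (if i ≠ j then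
        ∑ x ∈ Fintype.piFinset (fun _ : Fin 4 => Finset.Icc (-2 : ℤ) (N + 2)),
          ((if x j = 0 then u (x, i) ^ 2 else 0) + (if x j = N then u (x, i) ^ 2 else 0)) else 0) +
      ∑ i : Fin 4, ∑ j : Fin 4, (if i ≠ j then
        ∑ x ∈ Fintype.piFinset (fun _ : Fin 4 => Finset.Icc (-2 : ℤ) (N + 2)),
          ((if x i = 0 then u (x, j) ^ 2 else 0) + (if x i = N then u (x, j) ^ 2 else 0)) else 0) := by
    rw [← Finset.sum_add_distrib]
    refine Finset.sum_congr rfl fun i _ => ?_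
    rw [← Finset.sum_add_distrib]
    refine Finset.sum_congr rfl fun j _ => ?_
    by_cases h : i ≠ j
    · simp only [if_pos h]
    · simp only [if_neg h, add_zero]
  rw [hsplit, hswap] at hsum
  linarith

end Boundary

end Summit.QuantumFields.YangMills.Theorems.AllWindowsColdBoxBoxHighLine.HodgePoincare
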